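import Literature.MathematicalPhysics.QuantumLattice.FinDimSpectrumProofs
import HarnessLib

/-!
# Sourced Hamiltonians `K - hO`: variational (Hellmann–Feynman) inequalities for the tracial ground state

Family `hubbard` / trunk T-QLATTICE; elementary companions of `FinDimSpectrumProofs.lean`, written for the
Koma–Tasaki order parameter of `DWaveSource.lean` (consumer: `DWaveSourceProofs.lean`; requested by the
standing disprover of crux `WcbcsBcsConstruction`, route `HubbardSuperconductivity/WeakCouplingBCS`).
For Hermitian matrices `K` ("Hamiltonian") and `O` ("order operator") on a nonempty finite index type and
the family `K - hO`, `h ∈ ℝ`, with `E₀` = `Matrix.groundEnergy` and `ω_A` = `Matrix.groundStateFunctional A`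
(tracial ground state):

* `sub_mul_re_groundStateFunctional_le`: `(h' - h) · Re ω_{K-hO}(O) ≤ E₀(K - hO) - E₀(K - h'O)` — the
  ground state of `K - hO` is a trial state for `K - h'O` (`Matrix.groundEnergy_le_groundStateFunctional_re`);
  this is the finite-volume content of the concavity of `h ↦ E₀(K - hO)` and of the Hellmann–Feynman /
  Griffiths inequalities used by Koma–Tasaki (J. Stat. Phys. 76 (1994) 745, §1–2) to define order
  parameters through an infinitesimal symmetry-breaking field;
* consequences: the lower companion, MONOTONICITY of `h ↦ Re ω_{K-hO}(O)`, `E₀(K - hO) ≤ E₀(K)` whenever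
  `Re ω_K(O) = 0`, and the two-sided sandwich
  `(E₀(K) - E₀(K-hO))/h ≤ Re ω_{K-hO}(O) ≤ (E₀(K-hO) - E₀(K-2hO))/h` for `h > 0`;
* `groundStateFunctional_conj_of_commute_of_inverse`: invariance of the tracial ground state under an
  INVERTIBLE (not necessarily unitary) matrix commuting with the Hamiltonian (Koma–Tasaki's complex gauge
  rotations, PRL 68 (1992) 3248), complementing the unitary version
  `Matrix.groundStateFunctional_conj_of_commute`;
* a priori bounds `-‖Y‖ ≤ E₀(Y)` (spectrum inside the norm ball) and `|Re ω_A(X)| ≤ ‖X‖` for every `X`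
  (variational comparison with `±(X + Xᴴ)`), in the `L2Operator` (C⋆) norm.

All statements are folklore linear algebra; no named facts, no `sorry`. Mathlib/tree search: `lean search
"Hellmann|Feynman|groundStateFunctional_source|re_groundStateFunctional_le_norm"` — nothing beyond
`FinDimSpectrumProofs` (`groundEnergy_le_groundStateFunctional_re`, used here) and the rotor-specific
`re_groundStateFunctional_mono` (`QuantumRotorTruncatedInfrared`).
-/

noncomputable section

namespace Literature.MathematicalPhysics.QuantumLattice

open Matrix
open scoped Matrix.Norms.L2Operator ComplexOrder

section SourceInequalities

variable {n : Type*} [Fintype n] [DecidableEq n]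

omit [Fintype n] [DecidableEq n] in
/-- A real multiple of a Hermitian matrix subtracted from a Hermitian matrix is Hermitian. [folklore] -/
theorem isHermitian_sub_real_smul {K O : Matrix n n ℂ} (hK : K.IsHermitian) (hO : O.IsHermitian)
    (h : ℝ) : (K - (h : ℂ) • O).IsHermitian := by
  refine hK.sub (IsHermitian.smul hO ?_)
  rw [isSelfAdjoint_iff, Complex.star_def, Complex.conj_ofReal]

variable [Nonempty n]

/-- **Source (Griffiths/Hellmann–Feynman) inequality for the tracial ground state.**
For Hermitian `K`, `O` and real `h`, `h'`:
`(h' - h) · Re ω_{K - hO}(O) ≤ E₀(K - hO) - E₀(K - h'O)`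
(the ground state of `K - hO` is a trial state for `K - h'O`). [cite: KomaTasaki1994, §1] -/
theorem sub_mul_re_groundStateFunctional_le {K O : Matrix n n ℂ} (hK : K.IsHermitian)
    (hO : O.IsHermitian) (h h' : ℝ) :
    (h' - h) * ((K - (h : ℂ) • O).groundStateFunctional O).re ≤
      (K - (h : ℂ) • O).groundEnergy - (K - (h' : ℂ) • O).groundEnergy := by
  have hA := isHermitian_sub_real_smul hK hO h
  have hB := isHermitian_sub_real_smul hK hO h'
  have key := Matrix.groundEnergy_le_groundStateFunctional_re hA hB
  have hdecomp : K - (h' : ℂ) • O = (K - (h : ℂ) • O) - ((h' - h : ℝ) : ℂ) • O := by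
    rw [Complex.ofReal_sub, sub_smul]
    abel
  rw [hdecomp, map_sub, LinearMap.map_smul_of_tower, Matrix.groundStateFunctional_hamiltonian hA,
    Complex.sub_re, Complex.ofReal_re] at key
  have : (((h' - h : ℝ) : ℂ) • (K - (h : ℂ) • O).groundStateFunctional O).re =
      (h' - h) * ((K - (h : ℂ) • O).groundStateFunctional O).re := by
    rw [smul_eq_mul, Complex.re_ofReal_mul]
  rw [this] at key
  rw [hdecomp]
  linarith

/-- Lower companion: `(h - h'') · Re ω_{K - hO}(O) ≥ E₀(K - h''O) - E₀(K - hO)`. [folklore] -/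
theorem sub_groundEnergy_le_sub_mul_re_groundStateFunctional {K O : Matrix n n ℂ}
    (hK : K.IsHermitian) (hO : O.IsHermitian) (h h'' : ℝ) :
    (K - (h'' : ℂ) • O).groundEnergy - (K - (h : ℂ) • O).groundEnergy ≤
      (h - h'') * ((K - (h : ℂ) • O).groundStateFunctional O).re := by
  have := sub_mul_re_groundStateFunctional_le hK hO h h''
  linarith

/-- **Monotonicity of the sourced one-point function**: `h ↦ Re ω_{K - hO}(O)` is non-decreasing
(concavity of `h ↦ E₀(K - hO)`). [cite: KomaTasaki1994, §1] -/
theorem re_groundStateFunctional_source_mono {K O : Matrix n n ℂ} (hK : K.IsHermitian)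
    (hO : O.IsHermitian) {h h' : ℝ} (hle : h ≤ h') :
    ((K - (h : ℂ) • O).groundStateFunctional O).re ≤
      ((K - (h' : ℂ) • O).groundStateFunctional O).re := by
  rcases eq_or_lt_of_le hle with rfl | hlt
  · exact le_rfl
  have h1 := sub_mul_re_groundStateFunctional_le hK hO h h'
  have h2 := sub_groundEnergy_le_sub_mul_re_groundStateFunctional hK hO h' h
  have hpos : 0 < h' - h := sub_pos.2 hlt
  have : (h' - h) * ((K - (h : ℂ) • O).groundStateFunctional O).re ≤
      (h' - h) * ((K - (h' : ℂ) • O).groundStateFunctional O).re := h1.trans h2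
  exact le_of_mul_le_mul_left this hpos

/-- The sourced ground-state energy never exceeds the value at the source strength where the
one-point function vanishes: if `Re ω_K(O) = 0` then `E₀(K - hO) ≤ E₀(K)` for every real `h`. [folklore] -/
theorem groundEnergy_source_le_of_re_eq_zero {K O : Matrix n n ℂ} (hK : K.IsHermitian)
    (hO : O.IsHermitian) (h0 : (K.groundStateFunctional O).re = 0) (h : ℝ) :
    (K - (h : ℂ) • O).groundEnergy ≤ K.groundEnergy := by
  have := sub_mul_re_groundStateFunctional_le hK hO 0 h
  simp only [Complex.ofReal_zero, zero_smul, sub_zero] at this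
  rw [h0, mul_zero] at this
  linarith

/-- Two-sided energy sandwich of the sourced one-point function at `h > 0` when `Re ω_K(O) = 0`:
`(E₀(K) - E₀(K - hO))/h ≤ Re ω_{K-hO}(O) ≤ (E₀(K - hO) - E₀(K - 2hO))/h`. [cite: KomaTasaki1994, §1] -/
theorem re_groundStateFunctional_source_mem_Icc {K O : Matrix n n ℂ} (hK : K.IsHermitian)
    (hO : O.IsHermitian) {h : ℝ} (hh : 0 < h) :
    ((K - (h : ℂ) • O).groundStateFunctional O).re ∈
      Set.Icc ((K.groundEnergy - (K - (h : ℂ) • O).groundEnergy) / h)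
        (((K - (h : ℂ) • O).groundEnergy - (K - ((2 * h : ℝ) : ℂ) • O).groundEnergy) / h) := by
  constructor
  · rw [div_le_iff₀ hh]
    have := sub_groundEnergy_le_sub_mul_re_groundStateFunctional hK hO h 0
    simp only [Complex.ofReal_zero, zero_smul, sub_zero] at this
    linarith
  · rw [le_div_iff₀ hh]
    have := sub_mul_re_groundStateFunctional_le hK hO h (2 * h)
    linarith





end SourceInequalities

/-! ### Invariance under invertible symmetries; norm bounds -/

section Bounds

variable {n : Type*} [Fintype n] [DecidableEq n]

/-- Invariance of the tracial ground state under conjugation by an INVERTIBLE (not necessarily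
unitary) matrix commuting with the Hermitian `A`: `ω(G O G') = ω(O)` whenever `G' G = 1`
(Koma–Tasaki's complex gauge rotations are of this kind). [cite: KomaTasakiPRL1992, eqs. (5)–(8)] -/
theorem groundStateFunctional_conj_of_commute_of_inverse {A G G' : Matrix n n ℂ}
    (hA : A.IsHermitian) (hG : G * A = A * G) (hGG' : G' * G = 1) (O : Matrix n n ℂ) :
    A.groundStateFunctional (G * O * G') = A.groundStateFunctional O := by
  rw [groundStateFunctional_apply, groundStateFunctional_apply]
  congr 1
  calc (A.groundProj * (G * O * G')).trace = (G' * (A.groundProj * G * O)).trace := by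
        rw [trace_mul_comm G', ← mul_assoc, ← mul_assoc]
    _ = (A.groundProj * O).trace := by
        rw [groundProj_commute_of_commute hA hG, ← mul_assoc, ← mul_assoc, hGG', one_mul]


/-- Every point of the spectrum is bounded by the operator norm, hence `-‖Y‖ ≤ E₀(Y)` for a
Hermitian `Y`. [folklore] -/
theorem neg_norm_le_groundEnergy {Y : Matrix n n ℂ} (hY : Y.IsHermitian) [Nonempty n] :
    -‖Y‖ ≤ Y.groundEnergy := by
  rw [groundEnergy_eq_iInf_eigenvalues_holds hY]
  refine le_ciInf fun i => ?_
  have hmem : ((hY.eigenvalues i : ℝ) : ℂ) ∈ spectrum ℂ Y := by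
    rw [hY.spectrum_eq_image_range]
    exact ⟨_, ⟨i, rfl⟩, rfl⟩
  have h := spectrum.norm_le_norm_of_mem hmem
  rw [Complex.norm_real, Real.norm_eq_abs] at h
  linarith [neg_abs_le (hY.eigenvalues i)]


/-- `|Re ω_A(X)| ≤ ‖X‖` (operator norm) for the tracial ground state of a Hermitian `A`
(variational comparison with `±(X + Xᴴ)`, whose ground energies are `≥ -2‖X‖`). [folklore] -/
theorem abs_re_groundStateFunctional_le_norm {A : Matrix n n ℂ} (hA : A.IsHermitian) [Nonempty n]
    (X : Matrix n n ℂ) : |(A.groundStateFunctional X).re| ≤ ‖X‖ := by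
  have hY : (X + Xᴴ).IsHermitian := isHermitian_add_transpose_self X
  have hYn : (-(X + Xᴴ)).IsHermitian := hY.neg
  have hre : (A.groundStateFunctional (X + Xᴴ)).re = 2 * (A.groundStateFunctional X).re := by
    rw [map_add, Complex.add_re, groundStateFunctional_conjTranspose_re]
    ring
  have hnormY : ‖X + Xᴴ‖ ≤ 2 * ‖X‖ := by
    calc ‖X + Xᴴ‖ ≤ ‖X‖ + ‖Xᴴ‖ := norm_add_le _ _
      _ = 2 * ‖X‖ := by rw [l2_opNorm_conjTranspose]; ring
  have hlo := (neg_norm_le_groundEnergy hY).trans (groundEnergy_le_groundStateFunctional_re hA hY)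
  have hup := (neg_norm_le_groundEnergy hYn).trans (groundEnergy_le_groundStateFunctional_re hA hYn)
  rw [norm_neg, map_neg, Complex.neg_re] at hup
  rw [hre] at hlo hup
  rw [abs_le]
  constructor <;> linarith


end Bounds

end Literature.MathematicalPhysics.QuantumLattice

end
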